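import Mathlib
import Literature.Topology.FourManifolds.CircleSurgery
import Literature.Topology.FourManifolds.Trisections
import Literature.Topology.FourManifolds.SmoothOrientation
import HarnessLib

/-!
# LoopSurgeryHomotopySphere

Topic `Literature/Topology/FourManifolds`. Named literature fact(s) relocated by the gate from `Summits/SmoothPoincare4/SmoothPoincare4/Theorems/WeakReductionDescentWeakReductionReducesStubLoopNoDescentFromFiveAux2.lean`
(accept-time relocation of `[cite]`d propositions written inline in a Summits proposal; human ruling 2026-08-15).
Sources: ArandaZupan2025, GayKirby2016, GompfStipsiczGSM1999, HirschDT1976, LeeSmoothManifolds2013, MeierSchirmerZupan2016, Pao1977.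

* `Literature.Topology.FourManifolds.gkTrisection_sum_eq_add_two_of_loopSurgery_homotopySphere`
* `Literature.Topology.FourManifolds.isOrientable_of_isCircleSurgery_four`
* `Literature.Topology.FourManifolds.msz_loopSurgery_homotopySphere_gk`
-/

namespace Literature.Topology.FourManifolds

open scoped Manifold ContDiff ContinuousMap Topology
open Set
open Literature.Topology.FourManifolds

/-- **Orientability passes from a circle surgery back to the surgered manifold.**  Let the
smooth 4-manifold `P` be obtained from the smooth 4-manifold `X` by surgery on the circle
`ℓ : S¹ → X` (`Literature.Topology.FourManifolds.IsCircleSurgery (𝓡 4) (𝓡 4) X P ℓ`: for a tube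
`ν : S¹ × ℝ³ ↪ X` around `ℓ`, `P` is the open gluing of `X ∖ ℓ(S¹)` and `D̊² × S²` along
`circleSurgeryRel ν`; Gompf–Stipsicz (1999), §5.2).  If `P` is orientable then `X` is
orientable: the gluing map `jA` is a `C^∞` embedding of the open submanifold `X ∖ ℓ(S¹)` into `P`
with open range, so `X ∖ ℓ(S¹)` inherits an orientation (induced orientation along a
codimension-`0` immersion; Hirsch, *Differential Topology* (1976), §4.4, p. 101; tree:
`IsOrientable.of_isSmoothEmbedding`); the tube `ν(S¹ × ℝ³) ≅ S¹ × ℝ³` is orientable (product of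
orientable manifolds, Hirsch Ch. 5 §1; Lee, *Introduction to Smooth Manifolds* (2013),
Prop. 15.33) and meets `X ∖ ℓ(S¹)` in the CONNECTED open set `ν(S¹ × (ℝ³ ∖ 0))`, on which the
two orientations agree or are opposite (Hirsch §4.4, Thm. 4.3; tree:
`SmoothOrientation.eq_or_eq_neg_of_connectedSpace_holds`); after reversing the tube's
orientation if necessary they glue to an orientation of `X = (X ∖ ℓ(S¹)) ∪ ν(S¹ × ℝ³)`
(orientations form a sheaf; tree: `SmoothOrientation.glue`).  Orientability is the tree's
`Literature.Topology.FourManifolds.IsOrientable (𝓡 4)`; spaces in `Type`.  Users take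
`(h : isOrientable_of_isCircleSurgery_four)`.
[cite: HirschDT1976, §4.4 p. 101 and Thm. 4.3; Ch. 5 §1] [cite: LeeSmoothManifolds2013, Prop. 15.33]
[file Topology/FourManifolds/LoopSurgeryHomotopySphere] -/
def isOrientable_of_isCircleSurgery_four : Prop :=
  ∀ (X : Type) [TopologicalSpace X] [T2Space X] [SecondCountableTopology X] [ChartedSpace (EuclideanSpace ℝ (Fin 4)) X] [IsManifold (𝓡 4) ∞ X] (ℓ : (Metric.sphere (0 : EuclideanSpace ℝ (Fin 2)) 1) → X) (P : Type) [TopologicalSpace P] [T2Space P] [SecondCountableTopology P] [ChartedSpace (EuclideanSpace ℝ (Fin 4)) P] [IsManifold (𝓡 4) ∞ P], Literature.Topology.FourManifolds.IsCircleSurgery (𝓡 4) (𝓡 4) X P ℓ → Literature.Topology.FourManifolds.IsOrientable (𝓡 4) P → Literature.Topology.FourManifolds.IsOrientable (𝓡 4) X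

/-- **Meier–Schirmer–Zupan 2016, Thm. 1.2 (arXiv numbering), corollary for loop presentations
of homotopy 4-spheres.**  MSZ (arXiv:1507.06561, p. 2): "Suppose that `X` admits a
`(g; k₁, k₂, k₃)`–trisection `𝒯` with `k₁ ≥ g - 1`, and let `k' = max{k₂, k₃}`.  Then, `X` is
diffeomorphic either to `#^{k'}(S¹ × S³)` or to the connected sum of `#^{k'} S¹ × S³` with one
of `ℂP²` or `ℂP²bar`, and `𝒯` is the connected sum of genus one trisections" (for `X` closed,
connected, orientable, smooth: MSZ Def. 1.1; any sector may play the role of `X₁`).  COROLLARY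
recorded here: if moreover `M = X_ℓ` — a surgery on a smoothly embedded loop `ℓ ⊂ X`
(`Literature.Topology.FourManifolds.IsCircleSurgery`, either framing) — is a homotopy 4-sphere,
then `M ≅ S⁴`.  Indeed `χ(X_ℓ) = χ(X) + 2` (`X_ℓ = (X ∖ S¹ × B³) ∪ (D² × S²)`; Gompf–Stipsicz
(1999), §5.2) and `χ(M) = 2` give `χ(X) = 2 - 2k' + ε = 0` (`ε ∈ {0, 1}` the number of `±ℂP²`
summands), so `ε = 0`, `k' = 1`, `X ≅ S¹ × S³`; `π₁(M) = π₁(X)/⟨⟨[ℓ]⟩⟩` (Kosinski,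
*Differential Manifolds* (1993), X Lemma 1.2) is trivial, so `[ℓ]` normally generates
`π₁(S¹ × S³) = ℤ`, i.e. `[ℓ] = ±1`; loops in a 4-manifold are isotopic iff homotopic, so `M` is
one of the two surgeries `S_{±1}`, `S'_{±1}` on `ℓ_{±1} ⊂ S¹ × S³`, and "when `p = 1`, we have
that `S₁` and `S'₁` are diffeomorphic to `S⁴`" (Aranda–Zupan 2025, §2 p. 7; Pao 1977) — in the
tree both surgeries on the fibre circle of `S¹ × S³` are PROVED to give `S⁴`
(`Literature.Topology.FourManifolds.isCircleSurgery_sphereOne_prod_sphereThree_sphereFour`,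
`SphereFourCircleSurgery.lean`).  Shape as the tree's homotopy-sphere corollary
`Literature.Barriers.SmoothPoincare4.msz_homotopySphere_gk` (explicit `CompactSpace`,
`ConnectedSpace`, orientability; MSZ range `∃ i, g ≤ k i + 1`); spaces in `Type`.  Users take
`(h : msz_loopSurgery_homotopySphere_gk)`.
[cite: MeierSchirmerZupan2016, Thm. 1.2 (arXiv numbering)] [cite: ArandaZupan2025, §2 p. 7]
[cite: Pao1977, Thm. (S_1 ≅ S'_1 ≅ S⁴)] [cite: GompfStipsiczGSM1999, §5.2]
[file Topology/FourManifolds/LoopSurgeryHomotopySphere] -/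
def msz_loopSurgery_homotopySphere_gk : Prop :=
  ∀ (X : Type) [TopologicalSpace X] [T2Space X] [SecondCountableTopology X] [ChartedSpace (EuclideanSpace ℝ (Fin 4)) X] [IsManifold (𝓡 4) ∞ X] [CompactSpace X] [ConnectedSpace X], Literature.Topology.FourManifolds.IsOrientable (𝓡 4) X → ∀ (g : ℕ) (k : Fin 3 → ℕ) (S : Fin 3 → Set X), Literature.Topology.FourManifolds.IsGKTrisection X g k S → (∃ i, g ≤ k i + 1) → ∀ (ℓ : (Metric.sphere (0 : EuclideanSpace ℝ (Fin 2)) 1) → X), Manifold.IsSmoothEmbedding (𝓡 1) (𝓡 4) ∞ ℓ → ∀ (M : Type) [TopologicalSpace M] [T2Space M] [SecondCountableTopology M] [ChartedSpace (EuclideanSpace ℝ (Fin 4)) M] [IsManifold (𝓡 4) ∞ M], (M ≃ₕ (Metric.sphere (0 : EuclideanSpace ℝ (Fin 5)) 1)) → Literature.Topology.FourManifolds.IsCircleSurgery (𝓡 4) (𝓡 4) X M ℓ → Nonempty (Diffeomorph (𝓡 4) (𝓡 4) M (Metric.sphere (0 : EuclideanSpace ℝ (Fin 5)) 1) ∞)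

/-- **Euler characteristic of a trisected loop partner of a homotopy 4-sphere (Gay–Kirby 2016,
Remark 2 / Meier–Schirmer–Zupan 2016, Remark 3.12, with `χ` of a circle surgery), `χ`-free
form.**  Let `X` be a closed connected oriented smooth 4-manifold with a
`(g; k₀, k₁, k₂)`-GK-trisection; the induced handle decomposition gives
`χ(X) = 2 + g - k₀ - k₁ - k₂` (Gay–Kirby, Remark 2: "`χ(X) = 2 + g - 3k`"; MSZ Remark 3.12,
unbalanced form).  If a surgery `M = X_ℓ` on a smoothly embedded loop `ℓ ⊂ X`
(`IsCircleSurgery`, either framing) is homotopy equivalent to `S⁴`, then `χ(X) = χ(M) - 2 = 0`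
(`X_ℓ = (X ∖ S¹ × B³) ∪_{S¹ × S²} (D² × S²)`, so `χ(X_ℓ) = χ(X) - 0 + 2`; Gompf–Stipsicz (1999),
§5.2; `χ` is a homotopy invariant and `χ(S⁴) = 2`), hence `k₀ + k₁ + k₂ = g + 2`.  Vendored
`χ`-free, exactly as the tree's
`Literature.Topology.FourManifolds.gkTrisection_genus_eq_sum_of_homotopyEquiv_sphere` (the case
without surgery, `g = Σ kᵢ`, PROVED there via Čech Euler characteristics); spaces in `Type`.
Users take `(h : gkTrisection_sum_eq_add_two_of_loopSurgery_homotopySphere)`.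
[cite: GayKirby2016, Remark 2] [cite: MeierSchirmerZupan2016, Remark 3.12]
[cite: GompfStipsiczGSM1999, §5.2] [file Topology/FourManifolds/LoopSurgeryHomotopySphere] -/
def gkTrisection_sum_eq_add_two_of_loopSurgery_homotopySphere : Prop :=
  ∀ (X : Type) [TopologicalSpace X] [T2Space X] [SecondCountableTopology X] [ChartedSpace (EuclideanSpace ℝ (Fin 4)) X] [IsManifold (𝓡 4) ∞ X] [CompactSpace X] [ConnectedSpace X], Literature.Topology.FourManifolds.IsOrientable (𝓡 4) X → ∀ (g : ℕ) (k : Fin 3 → ℕ) (S : Fin 3 → Set X), Literature.Topology.FourManifolds.IsGKTrisection X g k S → ∀ (ℓ : (Metric.sphere (0 : EuclideanSpace ℝ (Fin 2)) 1) → X), Manifold.IsSmoothEmbedding (𝓡 1) (𝓡 4) ∞ ℓ → ∀ (M : Type) [TopologicalSpace M] [T2Space M] [SecondCountableTopology M] [ChartedSpace (EuclideanSpace ℝ (Fin 4)) M] [IsManifold (𝓡 4) ∞ M], (M ≃ₕ (Metric.sphere (0 : EuclideanSpace ℝ (Fin 5)) 1)) → Literature.Topology.FourManifolds.IsCircleSurgery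 (𝓡 4) (𝓡 4) X M ℓ → k 0 + k 1 + k 2 = g + 2

end Literature.Topology.FourManifolds
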